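import Mathlib
import Literature.Computability.AlgebraicComplexity.NestFreeMatchingPoly
import Summits.ValiantsHypothesis.ValiantsHypothesis.Theorems.FifoMatchingNNDivisionHardSplitFace
import Summits.ValiantsHypothesis.ValiantsHypothesis.Theorems.FifoMatchingNNDivisionHardUniversalTransport
import Summits.ValiantsHypothesis.ValiantsHypothesis.Theorems.FifoMatchingNNDivisionHardLinearTransportExplicit
import Summits.ValiantsHypothesis.ValiantsHypothesis.Theorems.FifoMatchingNNMonomialCofactorHard
import HarnessLib

/-!
# Route FifoMatching — crux `NNDivisionHard` (stmt-ValiantsHypothesis-21181): the ADJACENT-ARC FACE of the nest-free matching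
# polynomial and the unique-maximiser rung

For an ADJACENT ARC `e = (2b, 2b+1)` of `[0, 2(b+1+c))` (left block `L = [0, 2b)`, right block `R = [2b, 2(b+1+c))`, so
`e` is the first local arc `(0, 1)` of `R`) and the `0/1` direction `𝟙_e = UniversalTransport.indWeight e`:

* `stable_of_adjacent` — a nest-free perfect matching CONTAINING `e` stabilises `L` (an arc from `L` across `e` would nest
  over it);
* `weight_eq`, `weight_le_one`, `weight_eq_one_iff` — the `𝟙_e`-weight of a perfect matching is `[e ∈ M]`;
* `filter_max_eq_image` — the nest-free perfect matchings containing `e` are exactly the gluings `glue2 NL NR` with `NL`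
  nest-free on `[0, 2b)` and `NR` nest-free on `[0, 2(1+c))` containing the local arc `(0, 1)`;
* ★★ `topComponent_indWeight` — **THE ADJACENT-ARC FACE: `top_{𝟙_e}(NN_{b+1+c}) = ι_L(NN_b) · ι_R(S_e)`**, `S_e` the sum of
  the arc monomials of the nest-free perfect matchings of `[0, 2(1+c))` through `(0, 1)` (nonzero: `linkSum_ne_zero`);
* ★ `exists_adjacent_transport` — certificates restrict through the adjacent-arc face to the prefix block at cost `+1`
  (engine `LinearTransport.linear_transport`);
* ★★ `complexity_nn_mul_monomial_le_of_unique_max` / `complexity_nn_le_of_unique_max` (`'` = the `b + 1 ≤ n` form) — **the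
  UNIQUE-MAXIMISER RUNG (step (t3) of the hands' census): if ONE monomial `m₀` of `h` has strictly larger `x_e`-degree than
  every other monomial of `h`, then `L₊(NN_b · x^{m₀|L}) ≤ L₊(NN_n · h) + 2` and `L₊(NN_b) ≤ 16((2b+1)(L₊(NN_n · h)+3))²`.**

So a cofactor with a unique maximiser of the `x_{(2b,2b+1)}`-degree for some `b ≥ polylog(n)` is not a quasi-polynomial
certificate (crux currency as in `SplitFaceGeneric.prefixGeneric_not_certificate_qp`, same bookkeeping); e.g. the
two-matching cofactors `x^{kP} + x^{kQ}` whenever `P △ Q` contains an adjacent arc far from the left end.  The mirror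
statement (restriction to the SUFFIX block through the same arc) is left to the reversal symmetry of `NN_n`.
HONEST FRAMING: a rung; the residual of stmt-21181 stays OPEN (Hrubeš–Yehudayoff 2021 §6 Problem 2); nothing here bears
on `NNNotVP` or on VP ≠ VNP (NOT proved).
References: Chen–Deng–Du–Stanley–Yan 2007 §1 [ChenDengDuStanleyYan2007]; Jukna–Seiwert–Sergeev 2022 Thm 1
[JuknaSeiwertSergeev2022]; Bürgisser 2000 Rem. 2.7 [Burgisser2000].
-/

noncomputable section

-- Sub = Summit single-conjunct layout: the duplicated namespace component is mandated by the tree.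
set_option linter.dupNamespace false
set_option autoImplicit false

namespace Summit.ValiantsHypothesis.ValiantsHypothesis.Theorems.FifoMatching.NNDivisionHard.AdjacentArcFace

open Finset MvPolynomial Literature.Computability.AlgebraicComplexity
open Summit.ValiantsHypothesis.ValiantsHypothesis.Theorems.ZeroOneTransfer.Negative
  (topComponent coeff_topComponent support_topComponent_subset)
open Summit.ValiantsHypothesis.ValiantsHypothesis.Theorems.FifoMatching.NNDivisionHard.StackPowersQueue
  (blockEmb blockEmb_injective restrictM topComponent_sum_arcMonomial shiftMatching shiftMatching_mem)
open Summit.ValiantsHypothesis.ValiantsHypothesis.Theorems.FifoMatching.NNDivisionHard.UniversalTransport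
  (indWeight weight_indWeight)
open Summit.ValiantsHypothesis.ValiantsHypothesis.Theorems.FifoMatching.NNDivisionHard.LinearTransport
  (linear_transport linear_transport_monomial)
open Summit.ValiantsHypothesis.ValiantsHypothesis.Theorems.FifoMatching.NNDivisionHard.SplitFace
  (shiftR blockEmbR restrictR glue2 two_mul_le val_shiftR shiftR_injective blockEmbR_injective glue2_castLE
    glue2_shiftR glue2_mem glue2_restrict glue2_injective2 restrictM_mem' restrictR_mem arcMonomial_glue2
    support_rename_blockEmbR_outside)
open Summit.ValiantsHypothesis.ValiantsHypothesis.Theorems.DivisionGap.PerCofactorDegreeReduction.MonomialStripping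
  (complexity_le_of_monomial_mul)
open scoped NNReal BigOperators

variable {b c : ℕ}

/-! ### §1 The adjacent arc `e = (2b, 2b+1)` -/

/-- The local points `0, 1` of the right block `[0, 2(1+c))`. [folklore] -/
theorem two_pos' (c : ℕ) : 1 < 2 * (1 + c) := by omega

/-- The opener `2b` of the adjacent arc, as a point of `[0, 2(b+1+c))`. [folklore] -/
theorem val_opener : ((shiftR b (1 + c) ⟨0, by omega⟩ : Fin (2 * (b + (1 + c)))) : ℕ) = 2 * b := by
  rw [val_shiftR]; rfl

/-- The closer `2b+1` of the adjacent arc. [folklore] -/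
theorem val_closer : ((shiftR b (1 + c) ⟨1, two_pos' c⟩ : Fin (2 * (b + (1 + c)))) : ℕ) = 2 * b + 1 := by
  rw [val_shiftR]

/-- **A nest-free perfect matching containing the adjacent arc `(2b, 2b+1)` stabilises the left block `[0, 2b)`**: an arc
from the left block to the right of `2b+1` would nest over `(2b, 2b+1)`. [cite: ChenDengDuStanleyYan2007, §1] -/
theorem stable_of_adjacent {M : Fin (2 * (b + (1 + c))) → Fin (2 * (b + (1 + c)))}
    (hM : M ∈ nestFreeMatchings (2 * (b + (1 + c))))
    (he : M (shiftR b (1 + c) ⟨0, by omega⟩) = shiftR b (1 + c) ⟨1, two_pos' c⟩) :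
    ∀ i : Fin (2 * (b + (1 + c))), (i : ℕ) < 2 * b → (M i : ℕ) < 2 * b := by
  obtain ⟨hPM, hnest⟩ := mem_nestFreeMatchings.1 hM
  obtain ⟨hinv, -⟩ := mem_perfectMatchings.1 hPM
  have he' : M (shiftR b (1 + c) ⟨1, two_pos' c⟩) = shiftR b (1 + c) ⟨0, by omega⟩ := by rw [← he, hinv]
  intro i hi
  by_contra hge
  have h1 : M i ≠ shiftR b (1 + c) ⟨1, two_pos' c⟩ := by
    intro h
    have := congrArg M h
    rw [hinv, he'] at this
    have hv := congrArg Fin.val this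
    rw [val_shiftR] at hv
    simp at hv
    omega
  have h2 : M i ≠ shiftR b (1 + c) ⟨0, by omega⟩ := by
    intro h
    have := congrArg M h
    rw [hinv, he] at this
    have hv := congrArg Fin.val this
    rw [val_shiftR] at hv
    simp at hv
    omega
  have h1v : (M i : ℕ) ≠ 2 * b + 1 := fun h => h1 (Fin.ext (by rw [h, val_shiftR]))
  have h2v : (M i : ℕ) ≠ 2 * b := fun h => h2 (Fin.ext (by rw [h, val_shiftR]; rfl))
  refine hnest i (shiftR b (1 + c) ⟨0, by omega⟩) ?_ ?_ ?_
  · rw [Fin.lt_def, val_shiftR]; simp; omega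
  · rw [he, Fin.lt_def, val_shiftR, val_shiftR]; simp
  · rw [he, Fin.lt_def, val_shiftR]; simp; omega

/-! ### §2 Weights in the direction `𝟙_e` -/

/-- The `𝟙_e`-weight of the arc exponent of `M` is `[e ∈ M]`. [folklore] -/
theorem weight_eq (M : Fin (2 * (b + (1 + c))) → Fin (2 * (b + (1 + c)))) :
    Finsupp.weight (indWeight (blockEmbR b (1 + c) (⟨0, by omega⟩, ⟨1, two_pos' c⟩))) (arcExponent M) =
      if shiftR b (1 + c) ⟨0, by omega⟩ < M (shiftR b (1 + c) ⟨0, by omega⟩) ∧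
          M (shiftR b (1 + c) ⟨0, by omega⟩) = shiftR b (1 + c) ⟨1, two_pos' c⟩ then 1 else 0 := by
  classical
  rw [weight_indWeight]
  exact arcExponent_apply M _ _

/-- Hence at most `1`. [folklore] -/
theorem weight_le_one (M : Fin (2 * (b + (1 + c))) → Fin (2 * (b + (1 + c)))) :
    Finsupp.weight (indWeight (blockEmbR b (1 + c) (⟨0, by omega⟩, ⟨1, two_pos' c⟩))) (arcExponent M) ≤ 1 := by
  rw [weight_eq]; split_ifs <;> simp

/-- And equal to `1` iff `M` contains the arc `e`. [folklore] -/
theorem weight_eq_one_iff (M : Fin (2 * (b + (1 + c))) → Fin (2 * (b + (1 + c)))) :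
    Finsupp.weight (indWeight (blockEmbR b (1 + c) (⟨0, by omega⟩, ⟨1, two_pos' c⟩))) (arcExponent M) = 1 ↔
      M (shiftR b (1 + c) ⟨0, by omega⟩) = shiftR b (1 + c) ⟨1, two_pos' c⟩ := by
  rw [weight_eq]
  constructor
  · intro h
    by_contra hc'
    rw [if_neg (fun hc => hc' hc.2)] at h
    exact zero_ne_one h
  · intro h
    have hlt : shiftR b (1 + c) ⟨0, by omega⟩ < M (shiftR b (1 + c) ⟨0, by omega⟩) := by
      rw [h, Fin.lt_def, val_shiftR, val_shiftR]; simp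
    rw [if_pos ⟨hlt, h⟩]

/-! ### §3 The maximal matchings are the gluings with a right part through `(0, 1)` -/

/-- A right witness: the gluing of the unique matching of `[0, 2)` with the shift matching of `[0, 2c)` contains the local
arc `(0, 1)`. [folklore] -/
theorem rightWitness_zero :
    glue2 (shiftMatching 1) (shiftMatching c) ⟨0, by omega⟩ = (⟨1, two_pos' c⟩ : Fin (2 * (1 + c))) := by
  have h := glue2_castLE (shiftMatching 1) (shiftMatching c) (⟨0, by omega⟩ : Fin (2 * 1))
  have e0 : (Fin.castLE (two_mul_le 1 c) (⟨0, by omega⟩ : Fin (2 * 1)) : Fin (2 * (1 + c))) = ⟨0, by omega⟩ :=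
    Fin.ext rfl
  rw [e0] at h
  rw [h]
  apply Fin.ext
  rw [Fin.val_castLE]
  simp [shiftMatching]

/-- **The `𝟙_e`-maximal nest-free matchings are exactly the gluings `glue2 NL NR` with `NR ∋ (0, 1)`.** [folklore] -/
theorem filter_max_eq_image :
    (nestFreeMatchings (2 * (b + (1 + c)))).filter (fun M =>
        Finsupp.weight (indWeight (blockEmbR b (1 + c) (⟨0, by omega⟩, ⟨1, two_pos' c⟩))) (arcExponent M) = 1) =
      (nestFreeMatchings (2 * b) ×ˢ (nestFreeMatchings (2 * (1 + c))).filter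
          (fun NR => NR ⟨0, by omega⟩ = ⟨1, two_pos' c⟩)).image (fun p => glue2 p.1 p.2) := by
  ext M
  rw [Finset.mem_filter, Finset.mem_image]
  constructor
  · rintro ⟨hM, hW⟩
    have he := (weight_eq_one_iff M).1 hW
    have hPM := nestFreeMatchings_subset_perfectMatchings hM
    have hst := stable_of_adjacent hM he
    refine ⟨(restrictM (two_mul_le b (1 + c)) M, restrictR b (1 + c) M),
      Finset.mem_product.2 ⟨restrictM_mem' hM hst, Finset.mem_filter.2 ⟨restrictR_mem hM hst, ?_⟩⟩,
      glue2_restrict hPM hst⟩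
    apply Fin.ext
    show ((M (shiftR b (1 + c) ⟨0, by omega⟩) : ℕ)) - 2 * b = 1
    rw [he, val_shiftR]
    simp
  · rintro ⟨⟨NL, NR⟩, hp, rfl⟩
    obtain ⟨hNL, hNR'⟩ := Finset.mem_product.1 hp
    obtain ⟨hNR, h0⟩ := Finset.mem_filter.1 hNR'
    refine ⟨glue2_mem hNL hNR, (weight_eq_one_iff _).2 ?_⟩
    change glue2 NL NR (shiftR b (1 + c) ⟨0, by omega⟩) = shiftR b (1 + c) ⟨1, two_pos' c⟩
    rw [glue2_shiftR]
    exact congrArg (shiftR b (1 + c)) h0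

/-! ### §4 The adjacent-arc face -/

/-- The link sum `S_e` (nest-free perfect matchings of `[0, 2(1+c))` through `(0,1)`) is nonzero. [folklore] -/
theorem linkSum_ne_zero :
    (∑ NR ∈ (nestFreeMatchings (2 * (1 + c))).filter (fun NR => NR ⟨0, by omega⟩ = ⟨1, two_pos' c⟩),
      arcMonomial ℝ≥0 NR) ≠ 0 := by
  have hsub : (nestFreeMatchings (2 * (1 + c))).filter (fun NR => NR ⟨0, by omega⟩ = ⟨1, two_pos' c⟩) ⊆
      perfectMatchings (2 * (1 + c)) :=
    (Finset.filter_subset _ _).trans nestFreeMatchings_subset_perfectMatchings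
  have hmem : glue2 (shiftMatching 1) (shiftMatching c) ∈
      (nestFreeMatchings (2 * (1 + c))).filter (fun NR => NR ⟨0, by omega⟩ = ⟨1, two_pos' c⟩) :=
    Finset.mem_filter.2 ⟨glue2_mem (shiftMatching_mem 1) (shiftMatching_mem c), rightWitness_zero⟩
  intro h
  have hc := congrArg (coeff (arcExponent (glue2 (shiftMatching 1) (shiftMatching c)))) h
  rw [coeff_sum_arcMonomial hsub, if_pos ⟨_, hmem, rfl⟩, coeff_zero] at hc
  exact one_ne_zero hc

/-- ★★ **THE ADJACENT-ARC FACE: `top_{𝟙_e}(NN_{b+1+c}) = ι_L(NN_b) · ι_R(S_e)`** for the adjacent arc `e = (2b, 2b+1)`.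
[cite: ChenDengDuStanleyYan2007, §1] -/
theorem topComponent_indWeight :
    topComponent (indWeight (blockEmbR b (1 + c) (⟨0, by omega⟩, ⟨1, two_pos' c⟩)))
        (nestFreeMatchingPoly (b + (1 + c)) ℝ≥0) =
      rename (blockEmb (two_mul_le b (1 + c))) (nestFreeMatchingPoly b ℝ≥0) *
        rename (blockEmbR b (1 + c))
          (∑ NR ∈ (nestFreeMatchings (2 * (1 + c))).filter (fun NR => NR ⟨0, by omega⟩ = ⟨1, two_pos' c⟩),
            arcMonomial ℝ≥0 NR) := by
  have hG := glue2_mem (b := b) (shiftMatching_mem b) (glue2_mem (shiftMatching_mem 1) (shiftMatching_mem c))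
  have hGe : glue2 (shiftMatching b) (glue2 (shiftMatching 1) (shiftMatching c)) (shiftR b (1 + c) ⟨0, by omega⟩) =
      shiftR b (1 + c) ⟨1, two_pos' c⟩ := by
    rw [glue2_shiftR, rightWitness_zero]
  rw [nestFreeMatchingPoly_eq_sum_arcMonomial,
    topComponent_sum_arcMonomial _ nestFreeMatchings_subset_perfectMatchings (W := 1)
      (fun M _ => weight_le_one M) ⟨_, hG, (weight_eq_one_iff _).2 hGe⟩,
    filter_max_eq_image,
    Finset.sum_image fun p _ q _ h => Prod.ext (glue2_injective2 h).1 (glue2_injective2 h).2,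
    Finset.sum_product, nestFreeMatchingPoly_eq_sum_arcMonomial, map_sum, map_sum, Finset.sum_mul_sum]
  exact Finset.sum_congr rfl fun NL _ => Finset.sum_congr rfl fun NR _ => arcMonomial_glue2 NL NR

/-! ### §5 Transport through the adjacent-arc face and the unique-maximiser rung -/

/-- ★ **ADJACENT-ARC TRANSPORT.**  For every `h ≠ 0` there is `g ≠ 0` on the prefix block `[0, 2b)` with
`L₊(NN_b · g) ≤ L₊(NN_{b+1+c} · h) + 1`, `L₊(g) ≤ L₊(h)`, obtained through the `𝟙_{(2b,2b+1)}`-top component.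
[cite: Burgisser2000, Rem. 2.7] -/
theorem exists_adjacent_transport {h : MvPolynomial (Fin (2 * (b + (1 + c))) × Fin (2 * (b + (1 + c)))) ℝ≥0}
    (hh : h ≠ 0) :
    ∃ g : MvPolynomial (Fin (2 * b) × Fin (2 * b)) ℝ≥0, g ≠ 0 ∧
      complexity (nestFreeMatchingPoly b ℝ≥0 * g) ≤ complexity (nestFreeMatchingPoly (b + (1 + c)) ℝ≥0 * h) + 1 ∧
      complexity g ≤ complexity h :=
  linear_transport (blockEmb_injective (two_mul_le b (1 + c))) _ topComponent_indWeight
    (fun h0 => linkSum_ne_zero (c := c) (rename_injective _ blockEmbR_injective (by rw [h0, map_zero])))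
    (support_rename_blockEmbR_outside _) hh

/-- If one monomial `m₀` of `h` has strictly larger `x_e`-degree than all others, the `𝟙_e`-top component of `h` is
supported on `{m₀}`. [folklore] -/
theorem support_topComponent_subset_of_unique_max {σ : Type*} [DecidableEq σ] (e : σ)
    {h : MvPolynomial σ ℝ≥0} {m₀ : σ →₀ ℕ} (hm₀ : m₀ ∈ h.support)
    (huniq : ∀ m ∈ h.support, m ≠ m₀ → m e < m₀ e) :
    ∀ m ∈ (topComponent (indWeight e) h).support, m = m₀ := by
  classical
  intro m hm
  have hmh : m ∈ h.support := support_topComponent_subset _ h hm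
  rw [mem_support_iff, coeff_topComponent] at hm
  split_ifs at hm with hw
  · by_contra hne
    have hlt := huniq m hmh hne
    have hle : Finsupp.weight (indWeight e) m₀ ≤ weightedTotalDegree (indWeight e) h := le_weightedTotalDegree _ hm₀
    rw [← hw, weight_indWeight, weight_indWeight] at hle
    omega
  · exact absurd rfl hm

/-- ★★ **THE UNIQUE-MAXIMISER RUNG** (additive form): if ONE monomial `m₀` of `h` has strictly larger `x_{(2b,2b+1)}`-degree
than every other monomial of `h`, then `L₊(NN_b · x^{m₀|L}) ≤ L₊(NN_{b+1+c} · h) + 2`, `m₀|L` the restriction of `m₀` to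
the arcs of the prefix block. [cite: Burgisser2000, Rem. 2.7] -/
theorem complexity_nn_mul_monomial_le_of_unique_max
    {h : MvPolynomial (Fin (2 * (b + (1 + c))) × Fin (2 * (b + (1 + c)))) ℝ≥0}
    {m₀ : (Fin (2 * (b + (1 + c))) × Fin (2 * (b + (1 + c)))) →₀ ℕ} (hm₀ : m₀ ∈ h.support)
    (huniq : ∀ m ∈ h.support, m ≠ m₀ →
      m (blockEmbR b (1 + c) (⟨0, by omega⟩, ⟨1, two_pos' c⟩)) < m₀ (blockEmbR b (1 + c) (⟨0, by omega⟩, ⟨1, two_pos' c⟩))) :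
    complexity (nestFreeMatchingPoly b ℝ≥0 *
        monomial (m₀.comapDomain (blockEmb (two_mul_le b (1 + c))) (blockEmb_injective _).injOn) 1) ≤
      complexity (nestFreeMatchingPoly (b + (1 + c)) ℝ≥0 * h) + 2 := by
  classical
  have hh : h ≠ 0 := fun h0 => by rw [h0, support_zero] at hm₀; exact Finset.notMem_empty _ hm₀
  refine linear_transport_monomial (blockEmb_injective (two_mul_le b (1 + c))) _ topComponent_indWeight
    (fun h0 => linkSum_ne_zero (c := c) (rename_injective _ blockEmbR_injective (by rw [h0, map_zero])))
    (support_rename_blockEmbR_outside _) hh _ fun m hm t => ?_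
  rw [support_topComponent_subset_of_unique_max _ hm₀ huniq m hm, Finsupp.comapDomain_apply]

/-- ★★ **THE UNIQUE-MAXIMISER RUNG**, after Jukna–Seiwert–Sergeev stripping: `L₊(NN_b) ≤ 16((2b+1)(L₊(NN_{b+1+c} · h)+3))²`.
[cite: JuknaSeiwertSergeev2022, Thm 1] -/
theorem complexity_nn_le_of_unique_max
    {h : MvPolynomial (Fin (2 * (b + (1 + c))) × Fin (2 * (b + (1 + c)))) ℝ≥0}
    {m₀ : (Fin (2 * (b + (1 + c))) × Fin (2 * (b + (1 + c)))) →₀ ℕ} (hm₀ : m₀ ∈ h.support)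
    (huniq : ∀ m ∈ h.support, m ≠ m₀ →
      m (blockEmbR b (1 + c) (⟨0, by omega⟩, ⟨1, two_pos' c⟩)) < m₀ (blockEmbR b (1 + c) (⟨0, by omega⟩, ⟨1, two_pos' c⟩))) :
    complexity (nestFreeMatchingPoly b ℝ≥0) ≤
      16 * ((2 * b + 1) * (complexity (nestFreeMatchingPoly (b + (1 + c)) ℝ≥0 * h) + 3)) ^ 2 := by
  have H := complexity_nn_mul_monomial_le_of_unique_max hm₀ huniq
  rw [mul_comm (nestFreeMatchingPoly b ℝ≥0)] at H
  have H' : complexity (monomial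
      (m₀.comapDomain (blockEmb (two_mul_le b (1 + c))) (blockEmb_injective _).injOn) (1 : ℝ≥0) *
        nestFreeMatchingPoly b ℝ≥0) + 1 ≤ complexity (nestFreeMatchingPoly (b + (1 + c)) ℝ≥0 * h) + 3 := by omega
  calc complexity (nestFreeMatchingPoly b ℝ≥0)
      ≤ 16 * ((2 * b + 1) * (complexity (monomial
          (m₀.comapDomain (blockEmb (two_mul_le b (1 + c))) (blockEmb_injective _).injOn) (1 : ℝ≥0) *
            nestFreeMatchingPoly b ℝ≥0) + 1)) ^ 2 := complexity_le_of_monomial_mul (2 * b) _ _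
    _ ≤ 16 * ((2 * b + 1) * (complexity (nestFreeMatchingPoly (b + (1 + c)) ℝ≥0 * h) + 3)) ^ 2 := by gcongr

/-- ★★ **THE UNIQUE-MAXIMISER RUNG, `b + 1 ≤ n` form**: for the adjacent arc `e = (2b, 2b+1)` of `[0, 2n)`, if one monomial
of `h` has strictly larger `x_e`-degree than all others then `L₊(NN_b) ≤ 16((2b+1)(L₊(NN_n · h)+3))²`.
[cite: JuknaSeiwertSergeev2022, Thm 1] -/
theorem complexity_nn_le_of_unique_max' {n b : ℕ} (hb : b + 1 ≤ n)
    {h : MvPolynomial (Fin (2 * n) × Fin (2 * n)) ℝ≥0} {m₀ : (Fin (2 * n) × Fin (2 * n)) →₀ ℕ} (hm₀ : m₀ ∈ h.support)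
    (huniq : ∀ m ∈ h.support, m ≠ m₀ →
      m (⟨2 * b, by omega⟩, ⟨2 * b + 1, by omega⟩) < m₀ (⟨2 * b, by omega⟩, ⟨2 * b + 1, by omega⟩)) :
    complexity (nestFreeMatchingPoly b ℝ≥0) ≤
      16 * ((2 * b + 1) * (complexity (nestFreeMatchingPoly n ℝ≥0 * h) + 3)) ^ 2 := by
  obtain ⟨c, rfl⟩ : ∃ c, n = b + (1 + c) := ⟨n - b - 1, by omega⟩
  have he : (blockEmbR b (1 + c) (⟨0, by omega⟩, ⟨1, two_pos' c⟩) : Fin (2 * (b + (1 + c))) × Fin (2 * (b + (1 + c)))) =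
      (⟨2 * b, by omega⟩, ⟨2 * b + 1, by omega⟩) :=
    Prod.ext (Fin.ext (by simp [blockEmbR, val_shiftR])) (Fin.ext (by simp [blockEmbR, val_shiftR]))
  exact complexity_nn_le_of_unique_max hm₀ (fun m hm hne => by rw [he]; exact huniq m hm hne)

end Summit.ValiantsHypothesis.ValiantsHypothesis.Theorems.FifoMatching.NNDivisionHard.AdjacentArcFace

end
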